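import Summits.Ventures.HSemireg.Pad4TowerUniverseU8Mstar

/-!
# Venture HSemireg — PAD-4: the X-COLLAPSE of U8 in kernel form, (F1ℝ) slice — PART 2: the X-stage and the closure
# (RULE-D fixpoint ⇒ M*; O-next-to-unit-letter classes X-PHASE-dead; the core M*_X is Ψ-null but for N [2ℓ⁴]; Ψ-row ⇒ μ = 0)

HONEST FRAMING. Lean index of the computation cell `pub-hsemireg` (S4-PUSH, H2 door PAD-4); seat `hodge-semireg-assembly-p1`
(director-hodge g7∕g8 WIDTH-LEVER W2 on stmt-HodgeConjecture-18881). The U8 leg of the census entry-5 candidate **«X-COLLAPSE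
U6∕U7⁺∕U8» adca5a601d927b9f** (director-hodge g7 l.30504; chain bc5-plan g3 l.30489 (a)–(d), kit j276327∕j276329 «(H1)-ALIVE: NO ⇒
CLOSED»; ×2 s4-ref g73 5f7ec243906f3e2e: Z_X = 25, core M*_X = 30 orbits, «Ψ = 0 on 26∕30; the only non-null orbits are N [2ℓ⁴]_k,
Ψ = 16, P-side all Ψ-null ⇒ Ψ-row 16·Σ_k m = 0 ⇒ no FC mass»), universe U8 = {O, ℓ, 2ℓ, 3ℓ, 4ℓ, 2I+ℓ, 2I+2ℓ, 2I+3ℓ}, on the (F1ℝ)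
SLICE (phases `±1`), with the typed RULE D (`Pad4TowerLemmaT`), the fixpoint checker `Pad4TowerRuleDFixpoint`, and the
alphabet-free X-PHASE kill `Pad4TowerUniverseU6X.zx_xPhaseDead` (typed predicate `Pad4TowerLemmaA2I.XPhaseDead`).

THE CERTIFICATES (this seat's shape-level mirror `sim/shapelevel.py`, cell staging; the kernel re-validates independently): stage
1 = 7 rounds ∕ 531 shape certificates, M*(U8)^ℝ = 86 `N` + 43 `P` shapes (143 + 58 orbits counting the four phase classes of
O-free shapes = the 201 orbits of record); Z_X = the 25 `N`-shapes of M* with an O-factor and a unit letter (= g73's 25); X-stage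
= 7 rounds ∕ 77 certificates, M*_X = 18 `N` + 9 `P` shapes = 21 + 9 = 30 orbits (= g73's core 30), all Ψ-null except N
`[2ℓ|2ℓ|2ℓ|2ℓ]` (Ψ = 16), every other survivor O-carrying.

CONTENT (two files). PART 1 `Pad4TowerUniverseU8Mstar`: alphabet and stage 1 (M*(U8)). THIS FILE: §3 X-stage (`u8RoundsX`,
`u8MxN`, `u8MxP`, `u8RoundsX_ok` incl. the Ψ∕O table of the core, `u8_zxFree_subset_Mx`). §4 `u8_xcollapse`: letters in U8 +
RULE-D-closed support ⇒ (1) `N`-support phase-closed at its O-carrying cells ⇒ every `N`-constituent with an O-factor and a unit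
letter is `XPhaseDead`; (2) no such constituent + the Ψ-row ⇒ `μ = 0` (¬(H1)).

WHAT IS NOT HERE ∕ NOT IN LEAN. The (E1)-meaning of `XPhaseDead` and of RULE D (pencil); Ψ's annihilation of `ℚ[h] ⊕ W`; the μ₄
phases `±i`; S(D_T2); THEOREM FC1 (bc5-plan's M* used RULE D+FC1 — here RULE D alone; the X-core agrees, FC1 «not load-bearing»
per g73). Nothing is a statement about a variety, a sheaf, σ, a seed or an abelian variety; NOTHING HERE SAYS THAT HC ∕ HC_CM ∕
HC_AV ∕ W₆ ∕ HC_Kum4Type HOLDS OR FAILS. No `instance`, no notation, no named fact, 0 `sorry`; axioms standard. Letters below: `lO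
l1 l2 l3 t2Il t2I2l` (`Pad4TowerPsi`), `l4 = (4,0)`, `t2I3l = (4,1)`.

SOURCES (sha16): entry-5 candidate words adca5a601d927b9f; bc5-plan g3 l.30489, g4 l.30552 (kit j276327∕j276329), memo v3.2 §13
(H), `work/MstarX.json`; s4-ref g73 5f7ec243906f3e2e; PAD4-BALANCED §22; `Pad4TowerLemmaT.lean` bfb2cc0a1a90b649,
`Pad4TowerLemmaA2I.lean` f584dd8287830a21 §7; this seat's `Pad4TowerRuleDFixpoint` ∕ `Pad4TowerUniverseU6X`.
-/

namespace Summit.Ventures.HSemireg.Pad4Tower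

open Finset

/-! ## §3 X-stage: supports free of «O next to a unit letter» lie in the core M*_X(U8) -/

/-- the X-stage rounds, from (M*(U8) `N`-shapes without O-next-to-ℓ, M*(U8) `P`-shapes). -/
def u8RoundsX : List Round :=
  [ -- round 1: 0 N-shapes and 14 P-shapes leave
    ([],
     [⟨{lO, lO, l1, l1}, l1, true, lO, true⟩, ⟨{lO, lO, l1, l2}, l2, true, lO, true⟩, ⟨{lO, lO, l1, t2Il}, t2Il, true, lO, true⟩,
      ⟨{lO, lO, l1, l3}, l3, true, lO, true⟩, ⟨{lO, lO, l1, t2I2l}, t2I2l, true, lO, true⟩, ⟨{lO, lO, l1, l4}, l4, true, lO, true⟩,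
      ⟨{lO, l1, l1, l1}, l1, true, l1, false⟩, ⟨{lO, l1, l1, l2}, l1, true, l2, true⟩, ⟨{lO, l1, l1, t2Il}, l1, true, t2Il, true⟩,
      ⟨{lO, l1, l1, l3}, l1, true, l3, true⟩, ⟨{lO, l1, l2, l2}, l2, true, l2, false⟩, ⟨{lO, l1, l2, t2Il}, l2, true, t2Il, false⟩,
      ⟨{lO, l1, l2, l3}, l2, true, l3, true⟩, ⟨{lO, l1, l3, l3}, l3, true, l3, false⟩]),
    -- round 2: 26 N-shapes and 0 P-shapes leave
    ([⟨{lO, lO, l2, t2Il}, l2, false, t2Il, true⟩, ⟨{lO, lO, t2Il, t2Il}, t2Il, true, lO, true⟩, ⟨{lO, lO, t2Il, l3}, t2Il, true, l3, false⟩,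
      ⟨{lO, lO, t2Il, t2I2l}, t2Il, true, lO, true⟩, ⟨{lO, lO, t2Il, l4}, l4, false, t2Il, true⟩, ⟨{lO, lO, t2I2l, t2I2l}, t2I2l, true, lO, true⟩,
      ⟨{lO, lO, t2I2l, l4}, t2I2l, true, l4, false⟩, ⟨{lO, lO, l4, t2I3l}, l4, false, t2I3l, true⟩, ⟨{lO, l2, l2, t2Il}, l2, false, t2Il, true⟩,
      ⟨{lO, l2, t2Il, t2Il}, l2, false, t2Il, true⟩, ⟨{lO, l2, t2Il, l3}, l2, false, t2Il, true⟩, ⟨{lO, l2, l3, t2I2l}, t2I2l, true, l2, false⟩,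
      ⟨{lO, t2Il, l3, l3}, t2Il, true, l3, false⟩, ⟨{lO, l3, l3, t2I2l}, t2I2l, true, l3, false⟩, ⟨{l1, l1, l1, l1}, l1, true, l1, false⟩,
      ⟨{l1, l1, l1, l2}, l1, true, l1, false⟩, ⟨{l1, l1, l1, t2Il}, l1, true, l1, false⟩, ⟨{l1, l1, l1, l3}, l1, true, l1, false⟩,
      ⟨{l1, l1, l2, l2}, l1, true, l1, false⟩, ⟨{l1, l1, l2, t2Il}, l1, true, l1, false⟩, ⟨{l1, l1, l2, l3}, l1, true, l1, false⟩,
      ⟨{l1, l1, l3, l3}, l1, true, l1, false⟩, ⟨{l1, l2, l2, t2Il}, l1, false, l2, true⟩, ⟨{l1, l2, l2, l3}, l1, false, l2, true⟩,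
      ⟨{l1, l2, l3, l3}, l1, false, l2, true⟩, ⟨{l1, l3, l3, l3}, l1, false, l3, true⟩],
     []),
    -- round 3: 0 N-shapes and 14 P-shapes leave
    ([],
     [⟨{lO, lO, lO, t2Il}, t2Il, false, lO, true⟩, ⟨{lO, lO, l2, t2Il}, l2, true, t2Il, false⟩, ⟨{lO, lO, l2, t2I2l}, t2I2l, false, l2, false⟩,
      ⟨{lO, lO, l2, l4}, l4, true, l2, false⟩, ⟨{lO, lO, t2Il, t2Il}, t2Il, true, t2Il, false⟩, ⟨{lO, lO, t2Il, l3}, t2Il, false, l3, true⟩,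
      ⟨{lO, lO, l3, t2I2l}, t2I2l, false, l3, true⟩, ⟨{lO, lO, l3, l4}, l4, true, l3, false⟩, ⟨{lO, lO, l4, l4}, l4, true, l4, false⟩,
      ⟨{lO, l2, l2, t2Il}, l2, true, t2Il, false⟩, ⟨{l1, l1, l1, l1}, l1, true, l1, false⟩, ⟨{l1, l1, l1, l2}, l1, true, l2, true⟩,
      ⟨{l1, l1, l2, l2}, l1, false, l2, true⟩, ⟨{l1, l2, l2, l2}, l2, true, l2, false⟩]),
    -- round 4: 13 N-shapes and 0 P-shapes leave
    ([⟨{lO, lO, l2, t2I2l}, t2I2l, true, l2, false⟩, ⟨{lO, lO, l2, t2I3l}, l2, false, t2I3l, false⟩, ⟨{lO, lO, l3, t2I2l}, t2I2l, true, l3, false⟩,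
      ⟨{lO, lO, l3, t2I3l}, t2I3l, false, l3, false⟩, ⟨{lO, l2, l2, t2I2l}, l2, true, l2, false⟩, ⟨{lO, l2, l2, l4}, l4, false, l2, true⟩,
      ⟨{lO, l2, l3, l4}, l4, false, l2, true⟩, ⟨{lO, l2, l4, l4}, l4, false, l2, true⟩, ⟨{lO, l3, l3, l4}, l4, false, l3, true⟩,
      ⟨{lO, l3, l4, l4}, l4, false, l3, true⟩, ⟨{lO, l4, l4, l4}, l4, true, l4, false⟩, ⟨{l1, l2, l2, l2}, l1, false, l2, true⟩,
      ⟨{l2, l2, l2, t2Il}, l2, true, l2, false⟩],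
     []),
    -- round 5: 0 N-shapes and 5 P-shapes leave
    ([],
     [⟨{lO, lO, lO, t2I2l}, t2I2l, false, lO, true⟩, ⟨{lO, lO, lO, t2I3l}, t2I3l, true, lO, true⟩, ⟨{lO, l2, l2, l3}, l2, false, l3, true⟩,
      ⟨{lO, l2, l3, l3}, l2, false, l3, true⟩, ⟨{lO, l3, l3, l3}, l3, true, l3, false⟩]),
    -- round 6: 4 N-shapes and 0 P-shapes leave
    ([⟨{l2, l2, l2, l3}, l2, true, l2, false⟩, ⟨{l2, l2, l3, l3}, l2, true, l2, false⟩, ⟨{l2, l3, l3, l3}, l2, true, l3, false⟩,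
      ⟨{l3, l3, l3, l3}, l3, true, l3, false⟩],
     []),
    -- round 7: 0 N-shapes and 1 P-shapes leave
    ([],
     [⟨{l2, l2, l2, l2}, l2, true, l2, false⟩]) ]

/-- **M*_X(U8), `N`-side** (18 shapes). -/
def u8MxN : List (Multiset (ℕ × ℕ)) :=
  [ {lO, lO, lO, lO}, {lO, lO, lO, l2}, {lO, lO, lO, t2Il}, {lO, lO, lO, l3}, {lO, lO, lO, t2I2l}, {lO, lO, lO, l4}, {lO, lO, lO, t2I3l},
    {lO, lO, l2, l2}, {lO, lO, l2, l3}, {lO, lO, l2, l4}, {lO, lO, l3, l3}, {lO, lO, l3, l4}, {lO, lO, l4, l4}, {lO, l2, l2, l2}, {lO, l2, l2, l3},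
    {lO, l2, l3, l3}, {lO, l3, l3, l3}, {l2, l2, l2, l2} ]

/-- **M*_X(U8), `P`-side** (9 shapes). -/
def u8MxP : List (Multiset (ℕ × ℕ)) :=
  [ {lO, lO, lO, lO}, {lO, lO, lO, l1}, {lO, lO, lO, l2}, {lO, lO, lO, l3}, {lO, lO, lO, l4}, {lO, lO, l2, l2}, {lO, lO, l2, l3}, {lO, lO, l3, l3},
    {lO, l2, l2, l2} ]

/-- the X-stage certificate checks out, and the core's Ψ∕O table: every survivor has an O-factor and Ψ = 0, except the `N`-shape
`[2ℓ|2ℓ|2ℓ|2ℓ]` (no O, Ψ = 16 > 0); every `P`-survivor has an O-factor and Ψ = 0. [kernel, `decide`] -/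
theorem u8RoundsX_ok :
    CertsInj u8Keys u8RoundsX ∧
    roundsOK 4 ((u8MstarN.filter fun K => ¬ ZXKey K).map kenc) (u8MstarP.map kenc) u8RoundsX = true ∧
      (∀ K ∈ u8Keys, kenc K ∈ finalN ((u8MstarN.filter fun K => ¬ ZXKey K).map kenc) (u8MstarP.map kenc) u8RoundsX ↔
        K ∈ u8MxN) ∧
      (∀ K ∈ u8Keys, kenc K ∈ finalP ((u8MstarN.filter fun K => ¬ ZXKey K).map kenc) (u8MstarP.map kenc) u8RoundsX ↔
        K ∈ u8MxP) ∧
      (∀ K ∈ u8MxN ++ u8MxP, ((0, 0) ∈ K → psiKey K = 0) ∧ ((0, 0) ∉ K → 0 < psiKey K)) ∧ (∀ K ∈ u8MxP, (0, 0) ∈ K) := by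
  decide +kernel

/-- **X-STAGE**: a RULE-D-closed configuration inside U8^ℝ none of whose `N`-cells has an O-factor next to a unit letter has all its
shapes in M*_X(U8). -/
theorem u8_zxFree_subset_Mx (C : Config) (hC : RuleDClosed C) (hN : ∀ Z ∈ C.lower, InU8 Z) (hP : ∀ P ∈ C.upper, InU8 P)
    (hfree : ∀ Z ∈ C.lower, ¬ ZXKey Z.key) :
    (∀ Z ∈ C.lower, Z.key ∈ u8MxN) ∧ (∀ P ∈ C.upper, P.key ∈ u8MxP) := by
  obtain ⟨hMN, hMP⟩ := u8_support_subset_Mstar C hC hN hP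
  obtain ⟨hinj, hok, hdecN, hdecP, -⟩ := u8RoundsX_ok
  have hUN : ∀ Z ∈ C.lower, Z.key ∈ u8Keys := fun Z hZ => key_mem_keysOver (hN Z hZ)
  have hUP : ∀ P ∈ C.upper, P.key ∈ u8Keys := fun P hPu => key_mem_keysOver (hP P hPu)
  obtain ⟨hfN, hfP⟩ := rounds_sound hC hUN hUP (fun N hNl => coordBounded_of_letters u8Keys_spec.2 (hN N hNl)) u8RoundsX
    _ _ hinj hok (fun Z hZ => List.mem_map_of_mem (List.mem_filter.2 ⟨hMN Z hZ, decide_eq_true (hfree Z hZ)⟩))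
    (fun P hPu => List.mem_map_of_mem (hMP P hPu))
  exact ⟨fun Z hZ => (hdecN _ (hUN Z hZ)).1 (hfN Z hZ), fun P hPu => (hdecP _ (hUP P hPu)).1 (hfP P hPu)⟩

/-! ## §4 U8 is closed at first order modulo LEMMA X-PHASE -/

/-- **THE X-COLLAPSE OF U8 — (F1ℝ) SLICE, KERNEL FORM** (entry-5 candidate adca5a601d927b9f, U8 leg; bc5-plan g3∕g4, ×2 s4-ref g73): for a
two-level (F1ℝ) design with letters in the U8 alphabet and RULE-D-closed support, (1) if the `N`-support is phase-closed at its O-carrying cells (`SideClosed`), EVERY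
`N`-constituent with an O-factor and a unit letter satisfies `XPhaseDead`; (2) if NO `N`-constituent has such a shape (pencil
consequence of (1) — a HYPOTHESIS here) and the Ψ-row of the class condition holds, then `μ = 0` ((H1) fails): the support lies in
M*_X(U8), whose `P`-side is Ψ-null, so the Ψ-row kills the only positive `N`-shape `[2ℓ⁴]`, and every remaining constituent has an
O-factor. Nothing here says HC ∕ HC_CM ∕ HC_AV holds or fails. -/
theorem u8_xcollapse (lower upper : List Cell) (hN : ∀ Z ∈ lower, InU8 Z) (hP : ∀ P ∈ upper, InU8 P)
    (hD : RuleDClosed ⟨lower.toFinset, upper.toFinset⟩) :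
    (SideClosed lower.toFinset → ∀ Z ∈ lower, ZXKey Z.key →
        ∃ σ f : Fin 4, ∃ u : Fin 2, XPhaseDead ⟨lower.toFinset, upper.toFinset⟩ Z σ u f) ∧
      ((∀ Z ∈ lower, ¬ ZXKey Z.key) → psiSumC lower = psiSumC upper → muC lower upper = 0) := by
  refine ⟨fun hS Z hZ hk => zx_xPhaseDead _ hS (List.mem_toFinset.2 hZ) hk, fun hfree hΨ => ?_⟩
  obtain ⟨hinN, hinP⟩ := u8_zxFree_subset_Mx _ hD (fun Z hZ => hN Z (List.mem_toFinset.1 hZ))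
    (fun P hPu => hP P (List.mem_toFinset.1 hPu)) fun Z hZ => hfree Z (List.mem_toFinset.1 hZ)
  obtain ⟨-, -, -, -, htab, hPO⟩ := u8RoundsX_ok
  have hlowin : ∀ X ∈ lower, X.key ∈ u8MxN ++ u8MxP := fun X hX => List.mem_append_left _ (hinN X (List.mem_toFinset.2 hX))
  have hupin : ∀ X ∈ upper, X.key ∈ u8MxN ++ u8MxP := fun X hX => List.mem_append_right _ (hinP X (List.mem_toFinset.2 hX))
  -- the P-side Ψ-mass vanishes; N-terms are ≥ 0, so each vanishes, so every N has an O-factor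
  have hup : psiSumC upper = 0 := List.sum_eq_zero fun x hx => by
    obtain ⟨P, hPm, rfl⟩ := List.mem_map.1 hx
    rw [psi_eq_psiKey]; exact (htab _ (hupin P hPm)).1 (hPO _ (hinP P (List.mem_toFinset.2 hPm)))
  have hnn : ∀ x ∈ lower.map Cell.psi, (0 : ℚ) ≤ x := fun x hx => by
    obtain ⟨Z, hZ, rfl⟩ := List.mem_map.1 hx
    rw [psi_eq_psiKey]
    by_cases hO : (0, 0) ∈ Z.key
    · exact ((htab _ (hlowin Z hZ)).1 hO).ge
    · exact ((htab _ (hlowin Z hZ)).2 hO).le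
  have hO : ∀ Z ∈ lower, (0, 0) ∈ Z.key := fun Z hZ => by
    by_contra hno
    have hle : Z.psi ≤ psiSumC lower := List.single_le_sum hnn _ (List.mem_map.2 ⟨Z, hZ, rfl⟩)
    rw [hΨ, hup, psi_eq_psiKey] at hle
    exact absurd ((htab _ (hlowin Z hZ)).2 hno) (not_lt.2 hle)
  have hz : ∀ l : List Cell, (∀ X ∈ l, (0, 0) ∈ X.key) → (l.map muTermC).sum = 0 := fun l hl =>
    List.sum_eq_zero fun x hx => by
      obtain ⟨X, hX, rfl⟩ := List.mem_map.1 hx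
      obtain ⟨f, hf⟩ := exists_of_mem_key (hl X hX)
      exact muTermC_eq_zero_of_O hf
  unfold muC
  rw [hz lower hO, hz upper fun P hPm => hPO _ (hinP P (List.mem_toFinset.2 hPm)), sub_zero]

end Summit.Ventures.HSemireg.Pad4Tower
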